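import Summits.RiemannHypothesis.RiemannHypothesis.Theorems.SignConeGapRungDefs
import Summits.RiemannHypothesis.RiemannHypothesis.Theorems.SignConeGapRungOneLever

/-!
# `GapRung 1`, stub `stub_gap_mid` (`12 ≤ n₀ ≤ 112`) of line `gap-rung-one`
(crux `SignConeInequality`, stmt-RiemannHypothesis-16301; cell `Cruxes/SignConeInequality/`)

The registered regime stub, verbatim: `∀ n₀ : ℕ, 12 ≤ n₀ → n₀ ≤ 112 → ∀ a : ℝ, 0 < a → SingleGapAt n₀ a`
(`SingleGapAt`, `Theorems/SignConeGapRungDefs.lean`).  It is the `n₀ ≥ 11` lever theorem `singleGap_lever`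
(`Theorems/SignConeGapRungOneLever.lean`: argmin of `Re F` on the gap, deficit from the positive-definiteness lever,
signed far-field majorant, `Φ(n₀) ≥ −19/100`) read through the route's cone note (the item's `M`-form is definitionally
`Re (weilPolarTerm F + weilArchTerm F)`); the upper bound `n₀ ≤ 112` and the cutoff are not used.
-/

noncomputable section

-- `Summit.RiemannHypothesis.RiemannHypothesis.…` repeats a namespace component by design (D-0017 layout).
set_option linter.dupNamespace false

open scoped BigOperators ComplexConjugate

namespace Summit.RiemannHypothesis.RiemannHypothesis.Theorems.SignCone

open Literature.NumberTheory.LFunctions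

/-- **Stub `stub_gap_mid`** (line `gap-rung-one`, rung `GapRung 1`): one dirty node gap at `12 ≤ n₀ ≤ 112`, every cutoff. -/
theorem stub_gap_mid : ∀ n₀ : ℕ, 12 ≤ n₀ → n₀ ≤ 112 → ∀ a : ℝ, 0 < a → SingleGapAt n₀ a := by
  intro n₀ h₁ _h₂ a _ha k g hg F hn hgap M
  exact singleGap_lever (g := g) (F := F) rfl (fun i => (hg i).1) (le_trans (by norm_num) h₁) hn hgap

end Summit.RiemannHypothesis.RiemannHypothesis.Theorems.SignCone

end
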